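import Literature.AnabelianGeometry.EtaleTheta.FrobenioidMonoThetaEnv
import Literature.AnabelianGeometry.EtaleTheta.ThetaRigidity

/-!
# [EtTh] Lemma 5.9 (v): the pointwise content, derived from the bi-theta isomorphism of Lemma 5.9 (iv)

Mochizuki, *The étale theta function and its Frobenioid-theoretic manifestations*, Publ. RIMS **45**
(2009), Lemma 5.9 (v), p.332 (PDF p.106) [cite: MochizukiEtTh2009, Lem 5.9 (v) p.332 (PDF p.106)]: "In the
situation of (iv), the cyclotomic rigidity isomorphism arising from the theory of §2 [cf. Corollary 2.19,
(i)] coincides with the Frobenioid-theoretic isomorphism of Proposition 5.5 [where we take '`S`' to be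
`B_N`]."  abc-iut cell, DAG node `EtTh:Lem5.9(v)` (layer L2, cone of [IUTchIII] Cor. 3.12 via [IUTchII]
Prop. 1.3 (iii) / LC-L2-1), discharge seat abc-iut-w4-d042 (cross-layer).  PROOF-ONLY companion (no `def`, no
new named fact) of abc-iut-L2-t4's `FrobenioidMonoThetaEnv.lean` (`EnvIsoBiTheta`, `CycRigidityCoincide`) and
`FrobenioidCyclotomicRigidity.lean` (`IsKummerDetermined`), next to abc-iut-L2-t11's reduction
`cycRigidityCoincide_of` (`Discharge/Sec5BiThetaIso.lean`), whose hypothesis `h219` — an equation between the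
§2-side slot `ρ219` (a PARAMETER of `CycRigidityCoincide`) and the bi-Kummer difference
`s^⊓-gp_N · (s^⊔-gp_N)⁻¹` — is DERIVED here from the natural characterisation of the §2 side.

What the text's "in the situation of (iv)" gives: an isomorphism of mod `N` bi-theta environments
`i : E^Π_N ⥲ Π^tp_Y[μ_N]` lying over `Π^tp_Y̲` (L2-t4's typed Lemma 5.9 (iv) `EnvIsoBiTheta`; discharged by
L2-t11's `envIsoBiTheta_of`).  Such an `i` carries the `μ_N(B_N)`-conjugacy class of `Im(s^⊓-Π_N)` to the
`μ_N`-conjugacy class of `Im(s^alg_Ÿ)` and that of `Im(s^⊔-Π_N)` to that of `Im(s^Θ_Ÿ)` (Def. 2.13 (iii)); since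
`μ_N`-conjugation is TRIVIAL over `Δ` (the cyclotomic character factors through `G_K`), this pins `i`
POINTWISE on the sections over `Δ ∩ Π^tp_Ÿ`:

* `biThetaIso_sCapPi` / `biThetaIso_sCupPi` — `i(s^⊓-Π_N(y)) = s^alg_Ÿ(ι y)` and `i(s^⊔-Π_N(y)) = s^Θ_η(ι y)` for
  every `y ∈ Π^tp_Ÿ̲` with `aug(ι y) = 1`;
* `biThetaIso_sCapPi_mul_sCupPi_inv` — hence `i(s^⊓-Π_N(y) · s^⊔-Π_N(y)⁻¹) = μ(η(ι y))`: the bi-Kummer difference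
  on `Δ`-elements IS, under `i`, the §2 cocycle `η` (L2-t2's convention `s^Θ = η⁻¹ · s^alg`; print's
  orientation `s^⊓-gp_N · (s^⊔-gp_N)⁻¹` of Prop. 4.3 (iii) / Prop. 5.5 — no sign flip);
* `biThetaIso_sCapPi_mul_sCupPi_inv_of_mem_lDeltaTheta` — for a rigidity interface `R : RigidData` and
  `ι y ∈ l·Δ_Θ`: `= μ(θ-mod(ι y))`, THE cyclotomic rigidity identification of §2 (Cor. 2.19 (i); L2-t2's
  `RigidData.sAlg_mul_sTheta_inv`);
* **`biThetaIso_muIncl_rigidity`** — with Prop. 5.5's defining property BY NAME (L2-t4's `IsKummerDetermined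
  P ρ hB`): `i(ρ_{B_N}[proj(ρ y)]) = μ(η(ι y))` for every such `y` with `ρ y` in the theta pre-subgroup —
  **Lemma 5.9 (v) elementwise**: the Frobenioid-theoretic isomorphism of Prop. 5.5, carried into `Π^tp_Y[μ_N]`
  by the isomorphism of (iv), IS the §2 identification; no §2 ↔ §5 identification of `(l·Δ_Θ)` (the slot
  `ρ219`) is needed to STATE it;
* `cycRigidityCoincide_of_biTheta` — L2-t4's `CycRigidityCoincide ρ219 ρ hB` for every `ρ219` CHARACTERISED as
  "the §2 identification transported by the isomorphism of (iv)" (`hρ219`) on a covering family (`hcov`) —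
  i.e. L2-t11's `cycRigidityCoincide_of` with `h219` derived;
* `exists_biThetaIso_rigidity_of_envIsoBiTheta` — the `EnvIsoBiTheta`-packaged form.

SCOPE (abc-iut-L2-lead ruling 2026-08-26T02:02:06Z): the §2-side slot `ρ219` of `CycRigidityCoincide` is NOT
instantiated here (its pin `ρ219 :=` "the Cor. 2.19 (i) isomorphism transported to `(l·Δ_Θ)_{B_N} ⊗ ℤ/Nℤ`" needs the
§2 ↔ §5 identification of `(l·Δ_Θ)` — abc-iut-L2-t4's MERGE-PLAN row 10, owners L2-t4/L2-t11); this file supplies the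
pointwise transport statement that any such pin must satisfy (`hρ219`) and derives L2-t4's typed Lemma 5.9 (v) from it.

Hypotheses BY NAME only: the §5 binders of `frdBiThetaEnv` (`SectionsFactor`, `OuterActionLZ`, `SgpCapSection`,
`SgpCupSection`, `ConstantsEqNormalizer`, `DK`), the bi-theta isomorphism `i` with "lies over `ι`" and
"`ι(Π^tp_Ÿ̲) = Π^tp_Ÿ`" (conjuncts of `EnvIsoBiTheta`), `IsKummerDetermined`.  HONEST FRAMING: [EtTh] is refereed;
kernel-checked implications between its typed statements; nothing here bears on [IUTchIII] Cor. 3.12 and no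
side is taken; typed ≠ proved elsewhere.
-/

namespace Literature.AnabelianGeometry.EtaleTheta

open CategoryTheory
open FrobenioidCyclotomicRigidity

universe w v v' u u'

/-! ## Two facts about the cyclotomic envelope `Π^tp_Y[μ_N] = μ_N ⋊ Π^tp_Y` -/

namespace CycEnvelope

variable {P G μ : Type*} [Group P] [Group G] [CommGroup μ] (aug : P →* G) (χ : G →* MulAut μ)

/-- `μ_N`-conjugation is trivial over `Δ = Ker(aug)`: an element of `Π[μ_N]` lying over `Ker(Π ↠ G_K)`
commutes with the cyclotome (conjugation by `μ_N` = shift by a coboundary, which vanishes where the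
cyclotomic character is trivial). [cite: MochizukiEtTh2009, p.47] -/
theorem conj_inMu_eq_self_of_aug_eq_one (c : μ) (x : CycEnvelope aug χ) (hx : aug (proj aug χ x) = 1) :
    inMu aug χ c * x * (inMu aug χ c)⁻¹ = x := by
  have h := conj_inMu_eq_shift_coboundary aug χ c x
  rw [MulAut.conj_apply] at h
  rw [h]
  ext
  · change x.left * (c * ((χ.comp aug) x.right c)⁻¹) = x.left
    rw [MonoidHom.comp_apply, show aug x.right = 1 from hx, map_one, MulAut.one_apply, mul_inv_cancel,
      mul_one]
  · rfl

/-- A subgroup conjugate by `μ_N`: membership unfolds to a conjugate element. [cite: MochizukiEtTh2009, p.47] -/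
theorem mem_map_conj_inMu_iff (c : μ) (H : Subgroup (CycEnvelope aug χ)) (z : CycEnvelope aug χ) :
    z ∈ H.map (MulAut.conj (inMu aug χ c)).toMonoidHom ↔
      ∃ h ∈ H, z = inMu aug χ c * h * (inMu aug χ c)⁻¹ := by
  constructor
  · rintro ⟨h, hh, rfl⟩
    exact ⟨h, hh, rfl⟩
  · rintro ⟨h, hh, rfl⟩
    exact ⟨h, hh, rfl⟩

end CycEnvelope

namespace ThetaEnvData

variable {N : ℕ+} (T : ThetaEnvData.{u} N)

/-- The difference of the two sections is the cocycle: `s^alg_Ÿ(g) · s^Θ_η(g)⁻¹ = μ(η(g))` for every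
`g ∈ Π^tp_Ÿ` (L2-t2's convention `s^Θ_η(g) = η(g)⁻¹ · s^alg(g)`, Def. 2.13 (i) p.46).
[cite: MochizukiEtTh2009, Def 2.13(i) p.47] -/
theorem sAlg_mul_sTheta_inv_eq_inMu {η : T.PiYdd → T.mu} (hη : η ∈ T.thetaCocycles) (g : T.PiYdd) :
    T.sAlg g * (T.sTheta hη g)⁻¹ = CycEnvelope.inMu T.augY T.chi (η g) := by
  ext
  · simp [ThetaEnvData.sAlg, ThetaEnvData.sTheta]
  · simp [ThetaEnvData.sAlg, ThetaEnvData.sTheta]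

/-- `Π^tp_Y[μ_N] ↠ Π^tp_Y` on `s^alg_Ÿ(g)` is `g`. [cite: MochizukiEtTh2009, Def 2.13(i) p.47] -/
theorem proj_sAlg (g : T.PiYdd) : CycEnvelope.proj T.augY T.chi (T.sAlg g) = T.inclYdd g := rfl

/-- `Π^tp_Y[μ_N] ↠ Π^tp_Y` on `s^Θ_η(g)` is `g`. [cite: MochizukiEtTh2009, Def 2.13(i) p.47] -/
theorem proj_sTheta {η : T.PiYdd → T.mu} (hη : η ∈ T.thetaCocycles) (g : T.PiYdd) :
    CycEnvelope.proj T.augY T.chi (T.sTheta hη g) = T.inclYdd g := rfl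

/-- `aug` on `Π^tp_Y` through the inclusion of `Π^tp_Ÿ`. [cite: MochizukiEtTh2009, Def 2.13(i) p.47] -/
theorem augY_inclYdd (g : T.PiYdd) : T.augY (T.inclYdd g) = T.aug (g : T.PiX) := rfl

end ThetaEnvData

/-! ## Lemma 5.9 (v) pointwise, from the bi-theta isomorphism of (iv) -/

namespace ThetaFrobenioid

variable {C : Type u} [Category.{v} C] {D : Type u'} [Category.{v'} D] (𝔉 : ThetaFrobenioid.{w} C D)
  (h1 : 𝔉.SectionsFactor) (h3 : 𝔉.OuterActionLZ) (hsec : 𝔉.SgpCapSection) (hcs : 𝔉.SgpCupSection)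
  (h8 : 𝔉.ConstantsEqNormalizer) (DK : Set (TopOut 𝔉.EPiN))
  {N : ℕ+} (T : ThetaEnvData.{v} N) (ι : 𝔉.PiX ≃ₜ* T.PiX)
  {η : T.PiYdd → T.mu} (hη : η ∈ T.thetaCocycles)
  (i : (𝔉.frdBiThetaEnv h1 h3 hsec hcs h8 DK).Iso (T.modelBi hη))

/-- `ι` carries `Π^tp_Ÿ̲` into `Π^tp_Ÿ` (elementwise form of the `EnvIsoBiTheta` conjunct `ι(Π^tp_Ÿ̲) = Π^tp_Ÿ`).
[cite: MochizukiEtTh2009, Lem 5.9 (iv) p.332 (PDF p.106)] -/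
theorem iota_mem_PiYdd (hYdd : 𝔉.PiYdd.map ι.toMonoidHom = T.PiYdd) (y : 𝔉.PiYdd) : ι (y : 𝔉.PiX) ∈ T.PiYdd := by
  rw [← hYdd]
  exact ⟨y, y.2, rfl⟩

/-- `E^Π_N ↠ Π^tp_Y̲` on `s^⊓-Π_N(y)` is `y`. [cite: MochizukiEtTh2009, Lem 5.9 (iv) p.332 (PDF p.106)] -/
theorem toPiY_sCapPi (y : 𝔉.PiYdd) : 𝔉.toPiY (𝔉.sCapPi hsec y) = (y : 𝔉.PiX) := rfl

/-- `E^Π_N ↠ Π^tp_Y̲` on `s^⊔-Π_N(y)` is `y`. [cite: MochizukiEtTh2009, Lem 5.9 (iv) p.332 (PDF p.106)] -/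
theorem toPiY_sCupPi (y : 𝔉.PiYdd) : 𝔉.toPiY (𝔉.sCupPi h1 hcs y) = (y : 𝔉.PiX) := rfl

/-- The bi-theta isomorphism carries `Im(s^⊓-Π_N)` to a `μ_N`-conjugate of `Im(s^alg_Ÿ)` (its `map_sAlg` clause
read on the representative `Im(s^⊓-Π_N)` of the class). [cite: MochizukiEtTh2009, Lem 5.9 (iv) p.332 (PDF p.106)] -/
theorem exists_map_range_sCapPi_eq :
    ∃ c : T.mu, (𝔉.sCapPi hsec).range.map i.e.toMulEquiv.toMonoidHom =
      T.sAlg.range.map (MulAut.conj (CycEnvelope.inMu T.augY T.chi c)).toMonoidHom := by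
  have hmem : (𝔉.sCapPi hsec).range.map i.e.toMulEquiv.toMonoidHom ∈ (T.modelBi hη).sAlg := by
    rw [← i.map_sAlg]
    exact ⟨(𝔉.sCapPi hsec).range, ⟨1, by rw [map_one]; ext x; simp⟩, rfl⟩
  obtain ⟨c, hc⟩ := hmem
  exact ⟨c, hc⟩

/-- Likewise `Im(s^⊔-Π_N)` goes to a `μ_N`-conjugate of `Im(s^Θ_η)` (`map_sTheta`).
[cite: MochizukiEtTh2009, Lem 5.9 (iv) p.332 (PDF p.106)] -/
theorem exists_map_range_sCupPi_eq :
    ∃ c : T.mu, (𝔉.sCupPi h1 hcs).range.map i.e.toMulEquiv.toMonoidHom =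
      (T.sTheta hη).range.map (MulAut.conj (CycEnvelope.inMu T.augY T.chi c)).toMonoidHom := by
  have hmem : (𝔉.sCupPi h1 hcs).range.map i.e.toMulEquiv.toMonoidHom ∈ (T.modelBi hη).sTheta := by
    rw [← i.map_sTheta]
    exact ⟨(𝔉.sCupPi h1 hcs).range, ⟨1, by rw [map_one]; ext x; simp⟩, rfl⟩
  obtain ⟨c, hc⟩ := hmem
  exact ⟨c, hc⟩

/-- **`i(s^⊓-Π_N(y)) = s^alg_Ÿ(ι y)` ON THE NOSE for `y ∈ Π^tp_Ÿ̲` over `Δ`** (`aug(ι y) = 1`): the conjugate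
`μ(c) · s^alg(y′) · μ(c)⁻¹` that `i(s^⊓-Π_N(y))` must be (class clause) lies over `ι y` (the isomorphism lies
over `ι`), so `y′ = ι y`, and `μ_N`-conjugation is trivial over `Δ`.
[cite: MochizukiEtTh2009, Lem 5.9 (iv)/(v) p.332 (PDF p.106)] -/
theorem biThetaIso_sCapPi (hi : ∀ x : 𝔉.EPiN, ((CycEnvelope.proj T.augY T.chi (i.e x) : T.PiY) : T.PiX) = ι (𝔉.toPiY x))
    (hYdd : 𝔉.PiYdd.map ι.toMonoidHom = T.PiYdd) (y : 𝔉.PiYdd) (hy : T.aug (ι (y : 𝔉.PiX)) = 1) :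
    i.e (𝔉.sCapPi hsec y) = T.sAlg ⟨ι (y : 𝔉.PiX), 𝔉.iota_mem_PiYdd T ι hYdd y⟩ := by
  obtain ⟨c, hc⟩ := 𝔉.exists_map_range_sCapPi_eq h1 h3 hsec hcs h8 DK T hη i
  have hmem : i.e (𝔉.sCapPi hsec y) ∈ (𝔉.sCapPi hsec).range.map i.e.toMulEquiv.toMonoidHom :=
    ⟨𝔉.sCapPi hsec y, ⟨y, rfl⟩, rfl⟩
  rw [hc, CycEnvelope.mem_map_conj_inMu_iff] at hmem
  obtain ⟨_, ⟨y', rfl⟩, hyy'⟩ := hmem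
  -- `y′ = ι y`: compare the images in `Π^tp_Y`
  have hproj : ((CycEnvelope.proj T.augY T.chi (T.sAlg y') : T.PiY) : T.PiX) = ι (y : 𝔉.PiX) := by
    have h := hi (𝔉.sCapPi hsec y)
    rw [hyy', map_mul, map_mul, map_inv, 𝔉.toPiY_sCapPi hsec] at h
    simpa using h
  have hy' : y' = ⟨ι (y : 𝔉.PiX), 𝔉.iota_mem_PiYdd T ι hYdd y⟩ := Subtype.ext hproj
  subst hy'
  rw [hyy']
  exact CycEnvelope.conj_inMu_eq_self_of_aug_eq_one T.augY T.chi c _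
    (by rw [T.proj_sAlg, T.augY_inclYdd]; exact hy)

/-- **`i(s^⊔-Π_N(y)) = s^Θ_η(ι y)` ON THE NOSE** for `y ∈ Π^tp_Ÿ̲` over `Δ`, likewise.
[cite: MochizukiEtTh2009, Lem 5.9 (iv)/(v) p.332 (PDF p.106)] -/
theorem biThetaIso_sCupPi (hi : ∀ x : 𝔉.EPiN, ((CycEnvelope.proj T.augY T.chi (i.e x) : T.PiY) : T.PiX) = ι (𝔉.toPiY x))
    (hYdd : 𝔉.PiYdd.map ι.toMonoidHom = T.PiYdd) (y : 𝔉.PiYdd) (hy : T.aug (ι (y : 𝔉.PiX)) = 1) :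
    i.e (𝔉.sCupPi h1 hcs y) = T.sTheta hη ⟨ι (y : 𝔉.PiX), 𝔉.iota_mem_PiYdd T ι hYdd y⟩ := by
  obtain ⟨c, hc⟩ := 𝔉.exists_map_range_sCupPi_eq h1 h3 hsec hcs h8 DK T hη i
  have hmem : i.e (𝔉.sCupPi h1 hcs y) ∈ (𝔉.sCupPi h1 hcs).range.map i.e.toMulEquiv.toMonoidHom :=
    ⟨𝔉.sCupPi h1 hcs y, ⟨y, rfl⟩, rfl⟩
  rw [hc, CycEnvelope.mem_map_conj_inMu_iff] at hmem
  obtain ⟨_, ⟨y', rfl⟩, hyy'⟩ := hmem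
  have hproj : (y' : T.PiX) = ι (y : 𝔉.PiX) := by
    have h := hi (𝔉.sCupPi h1 hcs y)
    rw [hyy', map_mul, map_mul, map_inv, 𝔉.toPiY_sCupPi h1 hcs, T.proj_sTheta] at h
    simpa using h
  have hy' : y' = ⟨ι (y : 𝔉.PiX), 𝔉.iota_mem_PiYdd T ι hYdd y⟩ := Subtype.ext hproj
  subst hy'
  rw [hyy']
  exact CycEnvelope.conj_inMu_eq_self_of_aug_eq_one T.augY T.chi c _
    (by rw [T.proj_sTheta, T.augY_inclYdd]; exact hy)

/-- The bi-theta isomorphism on a quotient `a · b⁻¹` of elements of `E^Π_N` (bookkeeping: `E^Π_N` and the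
underlying group of `frdBiThetaEnv` are the same group). [cite: MochizukiEtTh2009, Lem 5.9 (iv) p.332 (PDF p.106)] -/
theorem biThetaIso_map_mul_inv (a b : 𝔉.EPiN) : i.e (a * b⁻¹) = i.e a * (i.e b)⁻¹ := by
  have h := map_mul i.e (a : (𝔉.frdBiThetaEnv h1 h3 hsec hcs h8 DK).Pi)
    ((b : (𝔉.frdBiThetaEnv h1 h3 hsec hcs h8 DK).Pi)⁻¹)
  rw [map_inv] at h
  exact h

/-- **The bi-Kummer difference IS the §2 cocycle under the isomorphism of (iv)**:
`i(s^⊓-Π_N(y) · s^⊔-Π_N(y)⁻¹) = μ(η(ι y))` for `y ∈ Π^tp_Ÿ̲` over `Δ`.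
[cite: MochizukiEtTh2009, Lem 5.9 (v) p.332 (PDF p.106)] -/
theorem biThetaIso_sCapPi_mul_sCupPi_inv (hi : ∀ x : 𝔉.EPiN, ((CycEnvelope.proj T.augY T.chi (i.e x) : T.PiY) : T.PiX) = ι (𝔉.toPiY x))
    (hYdd : 𝔉.PiYdd.map ι.toMonoidHom = T.PiYdd) (y : 𝔉.PiYdd) (hy : T.aug (ι (y : 𝔉.PiX)) = 1) :
    i.e (𝔉.sCapPi hsec y * (𝔉.sCupPi h1 hcs y)⁻¹) =
      CycEnvelope.inMu T.augY T.chi (η ⟨ι (y : 𝔉.PiX), 𝔉.iota_mem_PiYdd T ι hYdd y⟩) := by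
  rw [𝔉.biThetaIso_map_mul_inv h1 h3 hsec hcs h8 DK T hη i,
    𝔉.biThetaIso_sCapPi h1 h3 hsec hcs h8 DK T ι hη i hi hYdd y hy,
    𝔉.biThetaIso_sCupPi h1 h3 hsec hcs h8 DK T ι hη i hi hYdd y hy]
  exact T.sAlg_mul_sTheta_inv_eq_inMu hη _

/-- The bi-Kummer difference `s^⊓-Π_N(y) · s^⊔-Π_N(y)⁻¹ ∈ E^Π_N` is the element `(s^⊓-gp_N(ρ y) · s^⊔-gp_N(ρ y)⁻¹, 1)`,
i.e. the image under `μ_N(B_N) ↪ E^Π_N` of the `Aut_C(B_N)`-component (which lies in `μ_N(B_N)`: it is in the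
kernel of `E^Π_N ↠ Π^tp_Y̲`, Rmk. 5.10.3 / L2-t4's `toPiY_ker`). [cite: MochizukiEtTh2009, Prop 4.3 (iii) p.317 (PDF p.91)] -/
theorem sCapPi_mul_sCupPi_inv_mem_range_muIncl (y : 𝔉.PiYdd) :
    𝔉.sCapPi hsec y * (𝔉.sCupPi h1 hcs y)⁻¹ ∈ 𝔉.muIncl.range := by
  rw [← 𝔉.toPiY_ker hsec, MonoidHom.mem_ker, map_mul, map_inv, 𝔉.toPiY_sCapPi, 𝔉.toPiY_sCupPi,
    mul_inv_cancel]

/-- The `Aut_C(B_N)`-component of the bi-Kummer difference: `ϵ(s^⊓-Π_N(y) · s^⊔-Π_N(y)⁻¹) = s^⊓-gp_N(ρ y) · s^⊔-gp_N(ρ y)⁻¹`.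
[cite: MochizukiEtTh2009, Prop 4.3 (iii) p.317 (PDF p.91)] -/
theorem coe_sCapPi_mul_sCupPi_inv_fst (y : 𝔉.PiYdd) :
    ((𝔉.sCapPi hsec y * (𝔉.sCupPi h1 hcs y)⁻¹ : 𝔉.EPiN) : Aut 𝔉.BN × 𝔉.PiX).1 =
      𝔉.sgpCap (𝔉.ρ (y : 𝔉.PiX)) * (𝔉.sgpCup (𝔉.rhoYdd y))⁻¹ := rfl

/-- **[EtTh] Lemma 5.9 (v), ELEMENTWISE.**  With Prop. 5.5's defining property BY NAME (L2-t4's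
`IsKummerDetermined P ρ hB`: on `B_N`, `ρ_{B_N}` is read off from `h ↦ s^⊓-gp_N(h) · s^⊔-gp_N(h)⁻¹` over the theta
pre-subgroup), for every `y ∈ Π^tp_Ÿ̲` over `Δ` whose image `ρ y` lies in the theta pre-subgroup of `Aut_D(B_N^bs)`:
the Frobenioid-theoretic rigidity isomorphism of Prop. 5.5 at the class of `ρ y`, viewed in `E^Π_N` via
`μ_N(B_N) ↪ E^Π_N` and carried into `Π^tp_Y[μ_N]` by the isomorphism of (iv), IS `μ(η(ι y))` — the §2
identification (Cor. 2.19 (i)) of the same element. [cite: MochizukiEtTh2009, Lem 5.9 (v) p.332 (PDF p.106)] -/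
theorem biThetaIso_muIncl_rigidity (hi : ∀ x : 𝔉.EPiN, ((CycEnvelope.proj T.augY T.chi (i.e x) : T.PiY) : T.PiX) = ι (𝔉.toPiY x))
    (hYdd : 𝔉.PiYdd.map ι.toMonoidHom = T.PiYdd) (P : ThetaSubquotientProj 𝔉) (ρ : RigidityFamily 𝔉)
    (hB : 𝔉.IsThetaSaturated 𝔉.BN) (hρ : IsKummerDetermined 𝔉 P ρ hB) (y : 𝔉.PiYdd)
    (hy : T.aug (ι (y : 𝔉.PiX)) = 1)
    (hh : ((𝔉.rhoYdd y : 𝔉.HB) : Aut (𝔉.base.obj 𝔉.BN)) ∈ P.pre (𝔉.base.obj 𝔉.BN)) :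
    i.e (𝔉.muIncl (ρ 𝔉.BN hB (QuotientGroup.mk (P.proj _ ⟨_, hh⟩)))) =
      CycEnvelope.inMu T.augY T.chi (η ⟨ι (y : 𝔉.PiX), 𝔉.iota_mem_PiYdd T ι hYdd y⟩) := by
  rw [← 𝔉.biThetaIso_sCapPi_mul_sCupPi_inv h1 h3 hsec hcs h8 DK T ι hη i hi hYdd y hy]
  congr 1
  apply Subtype.ext
  apply Prod.ext
  · rw [coe_muIncl, coe_sCapPi_mul_sCupPi_inv_fst, hρ]
    rfl
  · obtain ⟨u, hu⟩ := 𝔉.sCapPi_mul_sCupPi_inv_mem_range_muIncl h1 hsec hcs y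
    rw [← hu, coe_muIncl, coe_muIncl]

/-! ## L2-t4's `CycRigidityCoincide` with the §2 slot characterised by transport -/

/-- **[EtTh] Lemma 5.9 (v) in abc-iut-L2-t4's typed form**, for every §2-side slot `ρ219` CHARACTERISED as "the
§2 identification transported by the isomorphism of (iv)" (`hρ219`: `i(μ_N(B_N) ∋ ρ219[proj(ρ y)]) = μ(η(ι y))`)
on a family of `y ∈ Π^tp_Ÿ̲` over `Δ` whose classes `[proj(ρ y)]` cover `(l·Δ_Θ)_{B_N} ⊗ ℤ/Nℤ` (`hcov`), and Prop. 5.5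
BY NAME (`IsKummerDetermined`): `ρ_{B_N} = ρ219` (`CycRigidityCoincide ρ219 ρ hB`).  This is L2-t11's
`cycRigidityCoincide_of` with its hypothesis `h219` DERIVED from `hρ219`.
[cite: MochizukiEtTh2009, Lem 5.9 (v) p.332 (PDF p.106)] -/
theorem cycRigidityCoincide_of_biTheta (hi : ∀ x : 𝔉.EPiN, ((CycEnvelope.proj T.augY T.chi (i.e x) : T.PiY) : T.PiX) = ι (𝔉.toPiY x))
    (hYdd : 𝔉.PiYdd.map ι.toMonoidHom = T.PiYdd) (P : ThetaSubquotientProj 𝔉) (ρ : RigidityFamily 𝔉)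
    (hB : 𝔉.IsThetaSaturated 𝔉.BN) (hρ : IsKummerDetermined 𝔉 P ρ hB)
    (ρ219 : 𝔉.lDeltaModN 𝔉.BN ≃* 𝔉.muTorsion 𝔉.BN 𝔉.N)
    (hcov : ∀ x : 𝔉.lDeltaModN 𝔉.BN, ∃ (y : 𝔉.PiYdd) (_ : T.aug (ι (y : 𝔉.PiX)) = 1)
      (hh : ((𝔉.rhoYdd y : 𝔉.HB) : Aut (𝔉.base.obj 𝔉.BN)) ∈ P.pre (𝔉.base.obj 𝔉.BN)),
      (QuotientGroup.mk (P.proj _ ⟨_, hh⟩) : 𝔉.lDeltaModN 𝔉.BN) = x)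
    (hρ219 : ∀ (y : 𝔉.PiYdd) (_ : T.aug (ι (y : 𝔉.PiX)) = 1)
      (hh : ((𝔉.rhoYdd y : 𝔉.HB) : Aut (𝔉.base.obj 𝔉.BN)) ∈ P.pre (𝔉.base.obj 𝔉.BN)),
      i.e (𝔉.muIncl (ρ219 (QuotientGroup.mk (P.proj _ ⟨_, hh⟩)))) =
        CycEnvelope.inMu T.augY T.chi (η ⟨ι (y : 𝔉.PiX), 𝔉.iota_mem_PiYdd T ι hYdd y⟩)) :
    𝔉.CycRigidityCoincide ρ219 ρ hB := by
  apply MulEquiv.ext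
  intro x
  obtain ⟨y, hy, hh, rfl⟩ := hcov x
  have hinj : Function.Injective 𝔉.muIncl := fun a b hab =>
    Subtype.ext (by simpa only [coe_muIncl] using congrArg (fun z : 𝔉.EPiN => (z : Aut 𝔉.BN × 𝔉.PiX).1) hab)
  apply hinj
  apply i.e.injective
  rw [𝔉.biThetaIso_muIncl_rigidity h1 h3 hsec hcs h8 DK T ι hη i hi hYdd P ρ hB hρ y hy hh, hρ219 y hy hh]

end ThetaFrobenioid

/-! ## Over a rigidity interface, and packaged over L2-t4's `EnvIsoBiTheta` -/

namespace ThetaFrobenioid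

variable {C : Type u} [Category.{v} C] {D : Type u'} [Category.{v'} D] (𝔉 : ThetaFrobenioid.{w} C D)
  (h1 : 𝔉.SectionsFactor) (h3 : 𝔉.OuterActionLZ) (hsec : 𝔉.SgpCapSection) (hcs : 𝔉.SgpCupSection)
  (h8 : 𝔉.ConstantsEqNormalizer) (DK : Set (TopOut 𝔉.EPiN))

/-- The same over a rigidity interface `R : RigidData` (L2-t2) for `y` with `ι y ∈ l·Δ_Θ` (automatically
over `Δ`): the common value is `μ(θ-mod(ι y))`, the cyclotomic rigidity identification
`(l·Δ_Θ) ↠ (l·Δ_Θ) ⊗ ℤ/Nℤ ⥲ μ_N` of Cor. 2.19 (i) (`cocycle_lDeltaTheta`).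
[cite: MochizukiEtTh2009, Lem 5.9 (v) p.332 (PDF p.106); Cor 2.19 (i) p.290 (PDF p.64)] -/
theorem biThetaIso_muIncl_rigidity_eq_thetaMod {N : ℕ+} {l : ℕ} (R : RigidData.{v} N l) (ι : 𝔉.PiX ≃ₜ* R.PiX)
    {η : R.PiYdd → R.mu} (hη : η ∈ R.thetaCocycles)
    (i : (𝔉.frdBiThetaEnv h1 h3 hsec hcs h8 DK).Iso (R.toThetaEnvData.modelBi hη))
    (hi : ∀ x : 𝔉.EPiN, ((CycEnvelope.proj R.augY R.chi (i.e x) : R.PiY) : R.PiX) = ι (𝔉.toPiY x))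
    (hYdd : 𝔉.PiYdd.map ι.toMonoidHom = R.PiYdd)
    (P : ThetaSubquotientProj 𝔉) (ρ : RigidityFamily 𝔉) (hB : 𝔉.IsThetaSaturated 𝔉.BN)
    (hρ : IsKummerDetermined 𝔉 P ρ hB) (y : 𝔉.PiYdd) (hy : ι (y : 𝔉.PiX) ∈ R.lDeltaTheta)
    (hh : ((𝔉.rhoYdd y : 𝔉.HB) : Aut (𝔉.base.obj 𝔉.BN)) ∈ P.pre (𝔉.base.obj 𝔉.BN)) :
    i.e (𝔉.muIncl (ρ 𝔉.BN hB (QuotientGroup.mk (P.proj _ ⟨_, hh⟩)))) =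
      CycEnvelope.inMu R.augY R.chi (R.thetaMod ⟨ι (y : 𝔉.PiX), hy⟩) := by
  have haug : R.aug (ι (y : 𝔉.PiX)) = 1 := (Subgroup.mem_inf.mp (R.lDeltaTheta_le hy)).2
  rw [𝔉.biThetaIso_muIncl_rigidity h1 h3 hsec hcs h8 DK R.toThetaEnvData ι hη i hi hYdd P ρ hB hρ y haug hh,
    R.cocycle_lDeltaTheta η hη _ hy]

/-! ## Packaged over L2-t4's `EnvIsoBiTheta` -/

/-- **Lemma 5.9 (v) elementwise, from Lemma 5.9 (iv) BY NAME** (`EnvIsoBiTheta`, whose isomorphism is extracted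
by choice): there are a cocycle `η` of the collection and an isomorphism of bi-theta environments
`i : E^Π_N ⥲ Π^tp_Y[μ_N]` over `ι` under which, for every `y ∈ Π^tp_Ÿ̲` over `Δ`, the bi-Kummer difference
`s^⊓-Π_N(y) · s^⊔-Π_N(y)⁻¹` goes to `μ(η(ι y))`, and — given Prop. 5.5 BY NAME — so does the Prop. 5.5 rigidity
isomorphism at `[proj(ρ y)]`. [cite: MochizukiEtTh2009, Lem 5.9 (iv)/(v) p.332 (PDF p.106)] -/
theorem exists_biThetaIso_rigidity_of_envIsoBiTheta {T : ThetaEnvData.{v} 𝔉.N} {ι : 𝔉.PiX ≃ₜ* T.PiX}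
    (h59iv : 𝔉.EnvIsoBiTheta h1 h3 hsec hcs h8 DK T ι) (P : ThetaSubquotientProj 𝔉) (ρ : RigidityFamily 𝔉)
    (hB : 𝔉.IsThetaSaturated 𝔉.BN) (hρ : IsKummerDetermined 𝔉 P ρ hB) :
    ∃ (η : T.PiYdd → T.mu) (hη : η ∈ T.thetaCocycles)
      (i : (𝔉.frdBiThetaEnv h1 h3 hsec hcs h8 DK).Iso (T.modelBi hη))
      (hYdd : 𝔉.PiYdd.map ι.toMonoidHom = T.PiYdd),
      (∀ x : 𝔉.EPiN, ((CycEnvelope.proj T.augY T.chi (i.e x) : T.PiY) : T.PiX) = ι (𝔉.toPiY x)) ∧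
      (∀ (y : 𝔉.PiYdd) (_ : T.aug (ι (y : 𝔉.PiX)) = 1),
        i.e (𝔉.sCapPi hsec y * (𝔉.sCupPi h1 hcs y)⁻¹) =
          CycEnvelope.inMu T.augY T.chi (η ⟨ι (y : 𝔉.PiX), 𝔉.iota_mem_PiYdd T ι hYdd y⟩)) ∧
      ∀ (y : 𝔉.PiYdd) (_ : T.aug (ι (y : 𝔉.PiX)) = 1)
        (hh : ((𝔉.rhoYdd y : 𝔉.HB) : Aut (𝔉.base.obj 𝔉.BN)) ∈ P.pre (𝔉.base.obj 𝔉.BN)),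
        i.e (𝔉.muIncl (ρ 𝔉.BN hB (QuotientGroup.mk (P.proj _ ⟨_, hh⟩)))) =
          CycEnvelope.inMu T.augY T.chi (η ⟨ι (y : 𝔉.PiX), 𝔉.iota_mem_PiYdd T ι hYdd y⟩) := by
  obtain ⟨-, hYdd, η, hη, i, hi, -⟩ := h59iv
  exact ⟨η, hη, i, hYdd, hi,
    fun y hy => 𝔉.biThetaIso_sCapPi_mul_sCupPi_inv h1 h3 hsec hcs h8 DK T ι hη i hi hYdd y hy,
    fun y hy hh => 𝔉.biThetaIso_muIncl_rigidity h1 h3 hsec hcs h8 DK T ι hη i hi hYdd P ρ hB hρ y hy hh⟩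

end ThetaFrobenioid

end Literature.AnabelianGeometry.EtaleTheta
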